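import Literature.Computability.Learning.AmpPFunction
import Literature.Computability.Learning.ModpDesignFP
import Literature.Computability.Complexity.CodeFPStringKit
import Literature.Computability.Complexity.CodeFPStrings
import HarnessLib

/-!
# `AMP_p(f)` from the oracle answers, in `FP`

Machine-layer groundwork for the named fact `Literature.Computability.Learning.cikk_learn_AC0Mod`
(CIKK 2016, Cor. 5.4): the learner fills the tables of the NW predictor with values of the
amplified function `AMP_p(f) = E^{vN} ∘ ((f^k)^{GL_p})^{2T}` (`AmpPFunction.lean`) on pattern
inputs, computed from the membership-query answers `f(x_{c,i})` at the `2Tk` points of the input.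
This file gives that computation as a numeric recipe and as a polynomial-time code:

* `blkValN`, `vnStepN`/`vnLN`, `ampPValN p n k β T u ans` — from the input bits `u` (layout
  `ampPIdxEquiv`: block `c` at `c(kn+kβ)`, point `i` at `+in`, position `i` at `+kn+iβ`, least
  significant bit first) and the answer bits `ans` (`f` at point `(c, i)` at index `ck + i`):
  `a_c = (Σᵢ posVal(c,i) · ans[ck+i]) mod p`, then von Neumann on `(a_{2j}, a_{2j+1})_j`;
* `ampPValN_eq` — on `u = bits of uf` and the true answers `ansOf f uf`, the recipe returns
  `ampPFin p f k β T uf`;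
* `ampPVal_codeFP` — the recipe is a `CodeFP` on `⟨⟨1ⁿ, ⟨1ᵏ, ⟨1^β, 1ᵀ⟩⟩⟩, ⟨u, ans⟩⟩`, and the
  string function `entryPFn` (`∈ FP`, `entryPFn_apply`).

## References

* M. Carmosino, R. Impagliazzo, V. Kabanets, A. Kolokolova, *Learning algorithms from natural
  proofs*, CCC 2016, §4.2, Thm. 4.8, §5 (complete algorithm, step 2) [CarmosinoImpagliazzoKabanetsKolokolova2016].
* S. Arora, B. Barak, *Computational Complexity: A Modern Approach*, CUP 2009, §1.3 [AroraBarak2009].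
-/

open Polynomial

namespace Literature.Computability.Learning

open Literature.Computability.Complexity Literature.Computability.Complexity.Brick
  Literature.Computability.Complexity.Plumb Literature.Computability.MetaComplexity
  Literature.Computability.Cryptography _root_.Computability Finset CodeFP

variable {p : ℕ} [hp : Fact p.Prime] {n k β T : ℕ}

/-! ### The numeric recipe -/

/-- The offset of position `i` of block `c`. [folklore] -/
def posOff (n k β c i : ℕ) : ℕ := c * (k * n + k * β) + k * n + i * β

/-- `a_c = (Σᵢ posVal(c, i) · ans[ck + i]) mod p`. [cite: CarmosinoImpagliazzoKabanetsKolokolova2016, §4.2] -/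
def blkValN (p n k β : ℕ) (u ans : List Bool) (c : ℕ) : ℕ :=
  ((List.range k).map fun i =>
    if ans.getD (c * k + i) false then bitsToNat ((u.drop (posOff n k β c i)).takeD β false) else 0).sum % p

/-- The absorbing fold of von Neumann's rule on numeric pairs: state `0` undecided, `1` decided
`0`, `2` decided `1`. [cite: CarmosinoImpagliazzoKabanetsKolokolova2016, Def. 4.5] -/
def vnStepN (ab : ℕ × ℕ) (s : ℕ) : ℕ :=
  if s = 0 then (if ab.1 = ab.2 then 0 else if ab.2 < ab.1 then 2 else 1) else s

/-- von Neumann's function on numeric pairs. [cite: CarmosinoImpagliazzoKabanetsKolokolova2016, Def. 4.5] -/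
def vnLN (l : List (ℕ × ℕ)) : Bool := !decide (l.foldl (fun s ab => vnStepN ab s) 0 = 1)

/-- **The recipe for `AMP_p(f)`** from the input bits and the answer bits.
[cite: CarmosinoImpagliazzoKabanetsKolokolova2016, §4.2 / Thm. 4.8] -/
def ampPValN (p n k β T : ℕ) (u ans : List Bool) : Bool :=
  vnLN ((List.range T).map fun j => (blkValN p n k β u ans (2 * j), blkValN p n k β u ans (2 * j + 1)))

/-! ### Correctness of the recipe -/

omit hp in
/-- The absorbing fold never returns to `0` once decided. [folklore] -/
theorem foldl_vnStepN_of_ne_zero (l : List (ℕ × ℕ)) {s : ℕ} (hs : s ≠ 0) : l.foldl (fun s ab => vnStepN ab s) s = s := by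
  induction l generalizing s with
  | nil => rfl
  | cons ab l ih => simp only [List.foldl_cons, vnStepN, hs, if_false]; exact ih hs

/-- von Neumann's rule on numeric pairs, recursively. [folklore] -/
def vnLNrec : List (ℕ × ℕ) → Bool
  | [] => true
  | ab :: l => if ab.1 = ab.2 then vnLNrec l else decide (ab.2 < ab.1)

omit hp in
/-- The fold computes the recursion. [folklore] -/
theorem vnLN_eq_rec (l : List (ℕ × ℕ)) : vnLN l = vnLNrec l := by
  induction l with
  | nil => rfl
  | cons ab l ih =>
      rw [vnLN, List.foldl_cons, vnLNrec]
      have h0 : vnStepN ab 0 = if ab.1 = ab.2 then 0 else if ab.2 < ab.1 then 2 else 1 := by simp [vnStepN]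
      rw [h0]
      by_cases h : ab.1 = ab.2
      · rw [if_pos h, if_pos h, ← ih, vnLN]
      · rw [if_neg h, if_neg h]
        by_cases hlt : ab.2 < ab.1
        · rw [if_pos hlt, foldl_vnStepN_of_ne_zero l (by norm_num)]; simp [hlt]
        · rw [if_neg hlt, foldl_vnStepN_of_ne_zero l (by norm_num)]; simp [hlt]

/-- **The numeric recursion is von Neumann's function** on pairs of field elements read through `val`.
[cite: CarmosinoImpagliazzoKabanetsKolokolova2016, Def. 4.5] -/
theorem vnLNrec_map_val (l : List (ZMod p × ZMod p)) : vnLNrec (l.map fun ab => (ab.1.val, ab.2.val)) = vnL l := by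
  induction l with
  | nil => rfl
  | cons ab l ih =>
      rw [List.map_cons, vnLNrec, vnL, ih]
      have hv : (ab.1.val = ab.2.val) ↔ ab.1 = ab.2 := (ZMod.val_injective p).eq_iff
      by_cases h : ab.1 = ab.2
      · rw [if_pos (hv.2 h), if_pos h]
      · rw [if_neg (fun h' => h (hv.1 h')), if_neg h]

/-- **The numeric fold is von Neumann's function** on pairs of field elements read through `val`.
[cite: CarmosinoImpagliazzoKabanetsKolokolova2016, Def. 4.5] -/
theorem vnLN_map_val (l : List (ZMod p × ZMod p)) : vnLN (l.map fun ab => (ab.1.val, ab.2.val)) = vnL l := by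
  rw [vnLN_eq_rec, vnLNrec_map_val]

omit hp in
/-- Reading a window of a bit vector. [folklore] -/
theorem drop_takeD_ofFn {N : ℕ} (uf : Fin N → Bool) {o m : ℕ} (h : o + m ≤ N) :
    ((List.ofFn uf).drop o).takeD m false = List.ofFn fun e : Fin m => uf ⟨o + e, by omega⟩ := by
  rw [List.takeD_eq_take _ (by simp; omega)]
  apply List.ext_getElem
  · simp; omega
  · intro d h1 h2
    simp [List.getElem_take, List.getElem_drop, List.getElem_ofFn]

omit hp in
/-- The coordinates of the `t`-th point of the cube are the binary digits of `t` (private copy of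
`MetaComplexity.boolFunEquivFin_symm_apply_eq_testBit` of `MCSPTreeWalk.lean`, whose import closure is
too heavy here; the public home of this fact is next to `boolFunEquivFin`). [folklore] -/
private theorem boolFunEquivFin_symm_apply_testBit (m : ℕ) (t : Fin (2 ^ m)) (j : Fin m) :
    (boolFunEquivFin m).symm t j = (t : ℕ).testBit j := by
  simp only [boolFunEquivFin, Equiv.symm_trans_apply, Equiv.arrowCongr_symm, Equiv.arrowCongr_apply, Equiv.symm_symm,
    Equiv.coe_refl, Function.comp_apply, id_eq, finTwoEquiv, Equiv.coe_fn_mk, Nat.testBit_eq_decide_div_mod_eq]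
  rcases Nat.mod_two_eq_zero_or_one ((t : ℕ) / 2 ^ (j : ℕ)) with h | h
  · simp [h, Fin.ext_iff]
  · simp [h, Fin.ext_iff]

omit hp in
/-- The binary digits of `posVal y` are `y`. [folklore] -/
theorem testBit_posVal {m : ℕ} (y : Fin m → Bool) (j : Fin m) : (posVal y).testBit j = y j := by
  have h := boolFunEquivFin_symm_apply_testBit m (boolFunEquivFin m y) j
  rw [Equiv.symm_apply_apply] at h
  exact h.symm

omit hp in
/-- `bitsToNat` of a bit vector is its index in the standard enumeration. [folklore] -/
theorem bitsToNat_ofFn_eq_posVal {m : ℕ} (y : Fin m → Bool) : bitsToNat (List.ofFn y) = posVal y := by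
  apply Nat.eq_of_testBit_eq
  intro e
  rw [Com.testBit_bitsToNat]
  by_cases he : e < m
  · rw [List.getD_eq_getElem _ _ (by simpa using he), List.getElem_ofFn, ← testBit_posVal y ⟨e, he⟩]
  · rw [List.getD_eq_default _ _ (by simpa using not_lt.1 he), eq_comm]
    exact Nat.testBit_eq_false_of_lt (lt_of_lt_of_le (posVal_lt y) (Nat.pow_le_pow_right (by norm_num) (not_lt.1 he)))

/-- The true answers: `f` at point `i` of block `c`, at index `ck + i`. [folklore] -/
def ansOf (f : (Fin n → Bool) → Bool) (uf : Fin (T * 2 * (k * n + k * β)) → Bool) : Fin (T * 2 * k) → Bool :=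
  fun m => f fun j => uf (ampPIdxEquiv n k β T ((finProdFinEquiv.symm m).1, Sum.inl ((finProdFinEquiv.symm m).2, j)))

omit hp in
/-- The index of a position bit. [folklore] -/
theorem ampPIdxEquiv_inr_val (c : Fin (T * 2)) (i : Fin k) (e : Fin β) :
    ((ampPIdxEquiv n k β T (c, Sum.inr (i, e)) : Fin (T * 2 * (k * n + k * β))) : ℕ) = posOff n k β c i + e := by
  simp [ampPIdxEquiv, finProdFinEquiv, posOff, Fin.natAdd]
  ring

omit hp in
/-- The index of a point bit. [folklore] -/
theorem ampPIdxEquiv_inl_val (c : Fin (T * 2)) (i : Fin k) (j : Fin n) :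
    ((ampPIdxEquiv n k β T (c, Sum.inl (i, j)) : Fin (T * 2 * (k * n + k * β))) : ℕ) = c * (k * n + k * β) + i * n + j := by
  simp [ampPIdxEquiv, finProdFinEquiv, Fin.castAdd]
  ring

omit hp in
/-- The answer at index `ck + i` is `f` at point `i` of block `c`. [folklore] -/
theorem ansOf_getD (f : (Fin n → Bool) → Bool) (uf : Fin (T * 2 * (k * n + k * β)) → Bool) (c : Fin (T * 2)) (i : Fin k) :
    (List.ofFn (ansOf f uf)).getD ((c : ℕ) * k + i) false = f ((blkOf (uf ∘ ampPIdxEquiv n k β T) c).1 i) := by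
  have hlt : (c : ℕ) * k + i < T * 2 * k := by
    have h1 : (c : ℕ) + 1 ≤ T * 2 := c.isLt
    have := Nat.mul_le_mul_right k h1
    rw [add_mul, one_mul] at this
    have := i.isLt
    omega
  rw [List.getD_eq_getElem _ _ (by simpa using hlt), List.getElem_ofFn]
  have hm : finProdFinEquiv.symm (⟨(c : ℕ) * k + i, hlt⟩ : Fin (T * 2 * k)) = (c, i) := by
    rw [Equiv.symm_apply_eq]; apply Fin.ext; simp [finProdFinEquiv]; ring
  simp only [ansOf, hm]
  rfl

omit hp in
/-- The position window of the input bits is the position. [folklore] -/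
theorem posWindow_eq (uf : Fin (T * 2 * (k * n + k * β)) → Bool) (c : Fin (T * 2)) (i : Fin k) :
    bitsToNat (((List.ofFn uf).drop (posOff n k β c i)).takeD β false) = posVal ((blkOf (uf ∘ ampPIdxEquiv n k β T) c).2 i) := by
  have hle : posOff n k β c i + β ≤ T * 2 * (k * n + k * β) := by
    have h1 : (c : ℕ) + 1 ≤ T * 2 := c.isLt
    have hc := Nat.mul_le_mul_right (k * n + k * β) h1
    rw [add_mul, one_mul] at hc
    have h2 : (i : ℕ) + 1 ≤ k := i.isLt
    have hi := Nat.mul_le_mul_right β h2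
    rw [add_mul, one_mul] at hi
    unfold posOff
    nlinarith
  rw [drop_takeD_ofFn uf hle, bitsToNat_ofFn_eq_posVal]
  congr 1
  funext e
  simp only [blkOf, Function.comp_apply]
  congr 1
  apply Fin.ext
  rw [ampPIdxEquiv_inr_val]

omit hp in
/-- A `range`-indexed map is an `ofFn`. [folklore] -/
theorem map_range_eq_ofFn {α : Type*} (m : ℕ) (g : ℕ → α) : (List.range m).map g = List.ofFn fun i : Fin m => g i := by
  rw [← List.map_coe_finRange_eq_range, List.map_map, List.ofFn_eq_map]
  rfl

/-- **`a_c` is the GL symbol of block `c`** (through `val`). [cite: CarmosinoImpagliazzoKabanetsKolokolova2016, §4.2] -/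
theorem blkValN_eq (f : (Fin n → Bool) → Bool) (uf : Fin (T * 2 * (k * n + k * β)) → Bool) (c : Fin (T * 2)) :
    blkValN p n k β (List.ofFn uf) (List.ofFn (ansOf f uf)) c = (blkG p f (blkOf (uf ∘ ampPIdxEquiv n k β T) c)).val := by
  set b := blkOf (uf ∘ ampPIdxEquiv n k β T) c with hb
  set t : Fin k → ℕ := fun i => if f (b.1 i) then posVal (b.2 i) else 0 with ht
  have hmap : ((List.range k).map fun i => if (List.ofFn (ansOf f uf)).getD ((c : ℕ) * k + i) false then
      bitsToNat (((List.ofFn uf).drop (posOff n k β c i)).takeD β false) else 0) = List.ofFn t := by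
    rw [map_range_eq_ofFn]
    congr 1
    funext i
    rw [ansOf_getD, posWindow_eq]
  have hG : blkG p f b = ((∑ i : Fin k, t i : ℕ) : ZMod p) := by
    unfold blkG dpGLP
    change ∑ i : Fin k, dpVecP f b.1 i * ((posVal (b.2 i) : ℕ) : ZMod p) = _
    rw [Nat.cast_sum]
    refine Finset.sum_congr rfl fun i _ => ?_
    simp only [dpVecP, ht]
    split_ifs <;> simp
  rw [blkValN, hmap, List.sum_ofFn, hG, ZMod.val_natCast]

/-- **The recipe computes `AMP_p(f)`** on genuine inputs and true answers.
[cite: CarmosinoImpagliazzoKabanetsKolokolova2016, §4.2 / Thm. 4.8] -/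
theorem ampPValN_eq (f : (Fin n → Bool) → Bool) (uf : Fin (T * 2 * (k * n + k * β)) → Bool) :
    ampPValN p n k β T (List.ofFn uf) (List.ofFn (ansOf f uf)) = ampPFin p f k β T uf := by
  have hamp : ampPFin p f k β T uf = vnL (List.ofFn (pairUp T fun c => blkG p f (blkOf (uf ∘ ampPIdxEquiv n k β T) c))) := rfl
  rw [hamp, ← vnLN_map_val, List.map_ofFn, ampPValN, map_range_eq_ofFn]
  congr 1
  congr 1
  funext j
  have h0 : ((finProdFinEquiv (j, (0 : Fin 2)) : Fin (T * 2)) : ℕ) = 2 * j := by simp [finProdFinEquiv]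
  have h1 : ((finProdFinEquiv (j, (1 : Fin 2)) : Fin (T * 2)) : ℕ) = 2 * j + 1 := by simp [finProdFinEquiv, add_comm]
  have e0 := blkValN_eq (p := p) f uf (finProdFinEquiv (j, (0 : Fin 2)))
  have e1 := blkValN_eq (p := p) f uf (finProdFinEquiv (j, (1 : Fin 2)))
  rw [h0] at e0
  rw [h1] at e1
  simp only [Function.comp_apply, pairUp_apply]
  rw [e0, e1]

/-! ### The recipe as a polynomial-time code -/

omit hp in
/-- The fold state stays in `{0, 1, 2}`. [folklore] -/
theorem foldl_vnStepN_le (l : List (ℕ × ℕ)) {s : ℕ} (hs : s ≤ 2) : l.foldl (fun s ab => vnStepN ab s) s ≤ 2 := by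
  induction l generalizing s with
  | nil => exact hs
  | cons ab l ih =>
      rw [List.foldl_cons]
      refine ih ?_
      unfold vnStepN
      split_ifs <;> omega

/-- The argument code `⟨⟨1ⁿ, ⟨1ᵏ, ⟨1^β, 1ᵀ⟩⟩⟩, ⟨u, ans⟩⟩`. [folklore] -/
abbrev ampArgE : (ℕ × (ℕ × (ℕ × ℕ))) × (List Bool × List Bool) → List Bool :=
  pairE (pairE unE (pairE unE (pairE unE unE))) (pairE strE strE)

omit hp in
/-- The argument code on a tuple. [folklore] -/
theorem ampArgE_apply (n k β T : ℕ) (u ans : List Bool) :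
    ampArgE ((n, (k, (β, T))), (u, ans)) =
      boolPair (boolPair (ones n) (boolPair (ones k) (boolPair (ones β) (ones T)))) (boolPair u ans) := by
  simp [ampArgE, pairE_apply, unE_eq_ones, strE]

/-- The von Neumann step is a code. [folklore] -/
theorem vnStepN_codeFP : CodeFP (pairE (pairE natE natE) natE) natE (fun t => vnStepN t.1 t.2) := by
  have hs : CodeFP (pairE (pairE natE natE) natE) natE (fun t => t.2) := snd _ _
  have ha : CodeFP (pairE (pairE natE natE) natE) natE (fun t => t.1.1) := (fst _ _).fst'
  have hb : CodeFP (pairE (pairE natE natE) natE) natE (fun t => t.1.2) := (fst _ _).snd'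
  have hs0 : CodeFP (pairE (pairE natE natE) natE) bitE (fun t => decide (t.2 = 0)) :=
    (natEq.comp (hs.pair (const _ 0))).congr fun _ => rfl
  have hab : CodeFP (pairE (pairE natE natE) natE) bitE (fun t => decide (t.1.1 = t.1.2)) :=
    (natEq.comp (ha.pair hb)).congr fun _ => rfl
  have hba : CodeFP (pairE (pairE natE natE) natE) bitE (fun t => decide (t.1.2 < t.1.1)) :=
    (natLt.comp (hb.pair ha)).congr fun _ => rfl
  have hinner : CodeFP (pairE (pairE natE natE) natE) natE
      (fun t => if decide (t.1.1 = t.1.2) then 0 else if decide (t.1.2 < t.1.1) then 2 else 1) :=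
    hab.ite (const _ 0) (hba.ite (const _ 2) (const _ 1))
  refine (hs0.ite hinner hs).congr fun t => ?_
  unfold vnStepN
  by_cases h0 : t.2 = 0
  · simp only [h0, decide_true, if_true]
    by_cases h1 : t.1.1 = t.1.2 <;> by_cases h2 : t.1.2 < t.1.1 <;> simp [h1, h2]
  · simp [h0]

variable (p)

omit hp in
/-- **The recipe `ampPValN` is a polynomial-time code.** [cite: AroraBarak2009, §1.3] -/
theorem ampPVal_codeFP :
    CodeFP ampArgE bitE (fun a => ampPValN p a.1.1 a.1.2.1 a.1.2.2.1 a.1.2.2.2 a.2.1 a.2.2) := by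
  -- parameters, in binary
  have hn : CodeFP ampArgE natE (fun a => a.1.1) := (natOfUn.comp (fst _ _).fst').congr fun _ => rfl
  have hk : CodeFP ampArgE natE (fun a => a.1.2.1) := (natOfUn.comp (fst _ _).snd'.fst').congr fun _ => rfl
  have hkU : CodeFP ampArgE unE (fun a => a.1.2.1) := (fst _ _).snd'.fst'
  have hβ : CodeFP ampArgE natE (fun a => a.1.2.2.1) := (natOfUn.comp (fst _ _).snd'.snd'.fst').congr fun _ => rfl
  have hβU : CodeFP ampArgE unE (fun a => a.1.2.2.1) := (fst _ _).snd'.snd'.fst'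
  have hTU : CodeFP ampArgE unE (fun a => a.1.2.2.2) := (fst _ _).snd'.snd'.snd'
  have hu : CodeFP ampArgE strE (fun a => a.2.1) := (snd _ _).fst'
  have hans : CodeFP ampArgE strE (fun a => a.2.2) := (snd _ _).snd'
  have huL : CodeFP ampArgE unE (fun a => a.2.1.length) := strLength.comp hu
  -- the term `(a, c, i) ↦ if ans[ck+i] then bitsToNat (window) else 0`
  let σ₁ : Type := (((ℕ × (ℕ × (ℕ × ℕ))) × (List Bool × List Bool)) × ℕ) × ℕ
  let e₁ : σ₁ → List Bool := pairE (pairE ampArgE natE) natE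
  have hA₁ : CodeFP e₁ ampArgE (fun t => t.1.1) := (fst _ _).fst'
  have hc₁ : CodeFP e₁ natE (fun t => t.1.2) := (fst _ _).snd'
  have hi₁ : CodeFP e₁ natE (fun t => t.2) := snd _ _
  have hidx : CodeFP e₁ natE (fun t => t.1.2 * t.1.1.1.2.1 + t.2) :=
    (natAdd.comp ((natMul.comp (hc₁.pair (hk.comp hA₁))).pair hi₁)).congr fun _ => rfl
  have hbit : CodeFP e₁ bitE (fun t => t.1.1.2.2.getD (t.1.2 * t.1.1.1.2.1 + t.2) false) :=
    (strGetDNat.comp ((hans.comp hA₁).pair hidx)).congr fun _ => rfl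
  have hoff : CodeFP e₁ natE (fun t => posOff t.1.1.1.1 t.1.1.1.2.1 t.1.1.1.2.2.1 t.1.2 t.2) :=
    ((natAdd.comp ((natAdd.comp ((natMul.comp (hc₁.pair (natAdd.comp ((natMul.comp ((hk.comp hA₁).pair (hn.comp hA₁))).pair
      (natMul.comp ((hk.comp hA₁).pair (hβ.comp hA₁))))))).pair (natMul.comp ((hk.comp hA₁).pair (hn.comp hA₁))))).pair
      (natMul.comp (hi₁.pair (hβ.comp hA₁)))))).congr fun _ => rfl
  have hoffU : CodeFP e₁ unE (fun t => min (posOff t.1.1.1.1 t.1.1.1.2.1 t.1.1.1.2.2.1 t.1.2 t.2) t.1.1.2.1.length) :=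
    (unOfNatMin.comp ((huL.comp hA₁).pair hoff)).congr fun _ => rfl
  have hwin : CodeFP e₁ strE (fun t => (t.1.1.2.1.drop (min (posOff t.1.1.1.1 t.1.1.1.2.1 t.1.1.1.2.2.1 t.1.2 t.2) t.1.1.2.1.length)).takeD
      t.1.1.1.2.2.1 false) :=
    (slice.comp (hoffU.pair ((hβU.comp hA₁).pair (hu.comp hA₁)))).congr fun _ => rfl
  have hval : CodeFP e₁ natE (fun t => bitsToNat ((t.1.1.2.1.drop (posOff t.1.1.1.1 t.1.1.1.2.1 t.1.1.1.2.2.1 t.1.2 t.2)).takeD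
      t.1.1.1.2.2.1 false)) :=
    (strVal.comp hwin).congr fun t => by
      congr 2
      by_cases h : posOff t.1.1.1.1 t.1.1.1.2.1 t.1.1.1.2.2.1 t.1.2 t.2 ≤ t.1.1.2.1.length
      · rw [min_eq_left h]
      · rw [min_eq_right (le_of_not_ge h), List.drop_length, List.drop_eq_nil_of_le (le_of_not_ge h)]
  have hterm : CodeFP e₁ natE (fun t => if t.1.1.2.2.getD (t.1.2 * t.1.1.1.2.1 + t.2) false then
      bitsToNat ((t.1.1.2.1.drop (posOff t.1.1.1.1 t.1.1.1.2.1 t.1.1.1.2.2.1 t.1.2 t.2)).takeD t.1.1.1.2.2.1 false) else 0) :=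
    hbit.ite hval (const _ 0)
  -- the block value `(a, c) ↦ a_c`
  have hrangeK : CodeFP (pairE ampArgE natE) (rawE natE) (fun s => List.range s.1.1.2.1) := urange.comp (hkU.comp (fst _ _))
  have hmap₁ := (CodeFP.map hterm).comp ((CodeFP.id (pairE ampArgE natE)).pair hrangeK)
  have hblk : CodeFP (pairE ampArgE natE) natE (fun s => blkValN p s.1.1.1 s.1.1.2.1 s.1.1.2.2.1 s.1.2.1 s.1.2.2 s.2) :=
    (natMod.comp ((natSum.comp hmap₁).pair (const _ p))).congr fun s => by
      simp only [blkValN, id]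
  -- the pairs `(a_{2j}, a_{2j+1})`
  have hA₂ : CodeFP (pairE ampArgE natE) ampArgE (fun s => s.1) := fst _ _
  have hj₂ : CodeFP (pairE ampArgE natE) natE (fun s => s.2) := snd _ _
  have h2j : CodeFP (pairE ampArgE natE) natE (fun s => 2 * s.2) := (natMul.comp ((const _ 2).pair hj₂)).congr fun _ => rfl
  have h2j1 : CodeFP (pairE ampArgE natE) natE (fun s => 2 * s.2 + 1) := (natAdd.comp (h2j.pair (const _ 1))).congr fun _ => rfl
  have hpairJ : CodeFP (pairE ampArgE natE) (pairE natE natE) (fun s =>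
      (blkValN p s.1.1.1 s.1.1.2.1 s.1.1.2.2.1 s.1.2.1 s.1.2.2 (2 * s.2), blkValN p s.1.1.1 s.1.1.2.1 s.1.1.2.2.1 s.1.2.1 s.1.2.2 (2 * s.2 + 1))) :=
    ((hblk.comp (hA₂.pair h2j)).pair (hblk.comp (hA₂.pair h2j1))).congr fun _ => rfl
  have hrangeT : CodeFP ampArgE (rawE natE) (fun a => List.range a.1.2.2.2) := urange.comp hTU
  have hpairs := (CodeFP.map hpairJ).comp ((CodeFP.id ampArgE).pair hrangeT)
  -- the fold and the output bit
  have hfold : CodeFP (rawE (pairE natE natE)) natE (fun l => l.foldl (fun s ab => vnStepN ab s) 0) :=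
    foldl₀ (step := fun ab s => vnStepN ab s) (b₀ := 0) vnStepN_codeFP (C 2) fun l₁ l₂ => by
      rw [eval_C]
      exact (length_natE_le _).trans (foldl_vnStepN_le l₁ (by norm_num))
  have hout : CodeFP (rawE (pairE natE natE)) bitE vnLN :=
    ((natEq.comp (hfold.pair (const _ 1))).not).congr fun l => by simp [vnLN]
  exact (hout.comp hpairs).congr fun a => by simp only [ampPValN, id]

/-- **The entry function of the `AC⁰[p]` learner's tables**: the string function of `ampPVal_codeFP`.
[cite: CarmosinoImpagliazzoKabanetsKolokolova2016, §5 (complete algorithm, step 2)] -/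
noncomputable def entryPFn : List Bool → List Bool := Classical.choose (ampPVal_codeFP p)

omit hp in
/-- `entryPFn ∈ FP`. [folklore] -/
theorem entryPFn_mem_FP : entryPFn p ∈ FP := (Classical.choose_spec (ampPVal_codeFP p)).1

omit hp in
/-- **Value of `entryPFn`** on every argument: the recipe. [folklore] -/
theorem entryPFn_apply (n k β T : ℕ) (u ans : List Bool) :
    entryPFn p (boolPair (boolPair (ones n) (boolPair (ones k) (boolPair (ones β) (ones T)))) (boolPair u ans)) =
      [ampPValN p n k β T u ans] := by
  rw [← ampArgE_apply]
  exact (Classical.choose_spec (ampPVal_codeFP p)).2 ((n, (k, (β, T))), (u, ans))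

/-- **On a genuine input with the true answers, `entryPFn` returns `AMP_p(f)`.**
[cite: CarmosinoImpagliazzoKabanetsKolokolova2016, §4.2 / §5 (step 2)] -/
theorem entryPFn_apply_ofFn (f : (Fin n → Bool) → Bool) (uf : Fin (T * 2 * (k * n + k * β)) → Bool) :
    entryPFn p (boolPair (boolPair (ones n) (boolPair (ones k) (boolPair (ones β) (ones T))))
      (boolPair (List.ofFn uf) (List.ofFn (ansOf f uf)))) = [ampPFin p f k β T uf] := by
  rw [entryPFn_apply, ampPValN_eq]

/-! ### The block value as a standalone code -/

section BlkCode

omit hp in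
/-- **`blkValN` is a polynomial-time code** on `⟨⟨⟨1ⁿ, ⟨1ᵏ, ⟨1^β, 1ᵀ⟩⟩⟩, ⟨u, ans⟩⟩, c⟩` (the inner
loop of `ampPVal_codeFP`, exposed for the learner's real labels `Σᵢ rᵢ f(xᵢ)` of the filler blocks).
[cite: AroraBarak2009, §1.3] -/
theorem blkValN_codeFP :
    CodeFP (pairE ampArgE natE) natE (fun s => blkValN p s.1.1.1 s.1.1.2.1 s.1.1.2.2.1 s.1.2.1 s.1.2.2 s.2) := by
  have hn : CodeFP ampArgE natE (fun a => a.1.1) := (natOfUn.comp (fst _ _).fst').congr fun _ => rfl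
  have hk : CodeFP ampArgE natE (fun a => a.1.2.1) := (natOfUn.comp (fst _ _).snd'.fst').congr fun _ => rfl
  have hkU : CodeFP ampArgE unE (fun a => a.1.2.1) := (fst _ _).snd'.fst'
  have hβ : CodeFP ampArgE natE (fun a => a.1.2.2.1) := (natOfUn.comp (fst _ _).snd'.snd'.fst').congr fun _ => rfl
  have hβU : CodeFP ampArgE unE (fun a => a.1.2.2.1) := (fst _ _).snd'.snd'.fst'
  have hu : CodeFP ampArgE strE (fun a => a.2.1) := (snd _ _).fst'
  have hans : CodeFP ampArgE strE (fun a => a.2.2) := (snd _ _).snd'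
  have huL : CodeFP ampArgE unE (fun a => a.2.1.length) := strLength.comp hu
  let σ₁ : Type := (((ℕ × (ℕ × (ℕ × ℕ))) × (List Bool × List Bool)) × ℕ) × ℕ
  let e₁ : σ₁ → List Bool := pairE (pairE ampArgE natE) natE
  have hA₁ : CodeFP e₁ ampArgE (fun t => t.1.1) := (fst _ _).fst'
  have hc₁ : CodeFP e₁ natE (fun t => t.1.2) := (fst _ _).snd'
  have hi₁ : CodeFP e₁ natE (fun t => t.2) := snd _ _
  have hidx : CodeFP e₁ natE (fun t => t.1.2 * t.1.1.1.2.1 + t.2) :=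
    (natAdd.comp ((natMul.comp (hc₁.pair (hk.comp hA₁))).pair hi₁)).congr fun _ => rfl
  have hbit : CodeFP e₁ bitE (fun t => t.1.1.2.2.getD (t.1.2 * t.1.1.1.2.1 + t.2) false) :=
    (strGetDNat.comp ((hans.comp hA₁).pair hidx)).congr fun _ => rfl
  have hoff : CodeFP e₁ natE (fun t => posOff t.1.1.1.1 t.1.1.1.2.1 t.1.1.1.2.2.1 t.1.2 t.2) :=
    ((natAdd.comp ((natAdd.comp ((natMul.comp (hc₁.pair (natAdd.comp ((natMul.comp ((hk.comp hA₁).pair (hn.comp hA₁))).pair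
      (natMul.comp ((hk.comp hA₁).pair (hβ.comp hA₁))))))).pair (natMul.comp ((hk.comp hA₁).pair (hn.comp hA₁))))).pair
      (natMul.comp (hi₁.pair (hβ.comp hA₁)))))).congr fun _ => rfl
  have hoffU : CodeFP e₁ unE (fun t => min (posOff t.1.1.1.1 t.1.1.1.2.1 t.1.1.1.2.2.1 t.1.2 t.2) t.1.1.2.1.length) :=
    (unOfNatMin.comp ((huL.comp hA₁).pair hoff)).congr fun _ => rfl
  have hwin : CodeFP e₁ strE (fun t => (t.1.1.2.1.drop (min (posOff t.1.1.1.1 t.1.1.1.2.1 t.1.1.1.2.2.1 t.1.2 t.2) t.1.1.2.1.length)).takeD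
      t.1.1.1.2.2.1 false) :=
    (slice.comp (hoffU.pair ((hβU.comp hA₁).pair (hu.comp hA₁)))).congr fun _ => rfl
  have hval : CodeFP e₁ natE (fun t => bitsToNat ((t.1.1.2.1.drop (posOff t.1.1.1.1 t.1.1.1.2.1 t.1.1.1.2.2.1 t.1.2 t.2)).takeD
      t.1.1.1.2.2.1 false)) :=
    (strVal.comp hwin).congr fun t => by
      congr 2
      by_cases h : posOff t.1.1.1.1 t.1.1.1.2.1 t.1.1.1.2.2.1 t.1.2 t.2 ≤ t.1.1.2.1.length
      · rw [min_eq_left h]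
      · rw [min_eq_right (le_of_not_ge h), List.drop_length, List.drop_eq_nil_of_le (le_of_not_ge h)]
  have hterm : CodeFP e₁ natE (fun t => if t.1.1.2.2.getD (t.1.2 * t.1.1.1.2.1 + t.2) false then
      bitsToNat ((t.1.1.2.1.drop (posOff t.1.1.1.1 t.1.1.1.2.1 t.1.1.1.2.2.1 t.1.2 t.2)).takeD t.1.1.1.2.2.1 false) else 0) :=
    hbit.ite hval (const _ 0)
  have hrangeK : CodeFP (pairE ampArgE natE) (rawE natE) (fun s => List.range s.1.1.2.1) := (urange.comp (hkU.comp (fst _ _))).congr fun _ => rfl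
  have hmap₁ := (CodeFP.map hterm).comp ((CodeFP.id (pairE ampArgE natE)).pair hrangeK)
  exact (natMod.comp ((natSum.comp hmap₁).pair (const _ p))).congr fun s => by simp only [blkValN, id]

end BlkCode

end Literature.Computability.Learning
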